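import Mathlib
import Literature.Analysis.FluidPDE.VorticityCalculus
import Summits.NavierStokesRegularity.NavierStokesRegularity.Theorems.SlicedKelvinPlanarFluxAPrioriEpsilonLimit

/-!
# Crux `SlicedKelvin.PlanarFluxAPriori` (stmt-NavierStokesRegularity-15600), line `registered`:
  pointwise calculus of the regularised normal vorticity `F_ε(f) = √(f² + ε²)`, `f = ⟪curl v, n⟫`
  (helper for `stub_foldLawPackage`)

Helper file of the stub `stub_foldLawPackage` (the ε-fold-law subsolution package
`Theorems.SlicedKelvin.FoldLawSubsolution`) of the skeleton `Cruxes/PlanarFluxAPriori/Lines/birth.lean`.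
The package differentiates, in time and twice along the normal `n = R e₂`, the regularised flux density
`F_ε(f)`, `f = ⟪curl v, n⟫`, `F_ε(s) = √(s² + ε²)`, of a field `v : ℝ³ → ℝ³`. This file is the pointwise
calculus behind those derivatives:

* the regularisation: `F_ε' = s/F_ε ∈ [−1, 1]`, `F_ε'' = ε²/F_ε³ ∈ [0, ε⁻¹]`, `ε²/F_ε ≤ ε`
  (`hasDerivAt_sqrt_sq_add_sq`, `hasDerivAt_div_sqrt_sq_add_sq`, `abs_div_sqrt_sq_add_sq_le_one`, …);
* chain rules for `x ↦ F_ε(φ x)`, `φ : ℝ³ → ℝ` of class `C²`: `D(F_ε∘φ) = F_ε'(φ) Dφ`,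
  `D²(F_ε∘φ) = F_ε'(φ) D²φ + F_ε''(φ) Dφ ⊗ Dφ`, hence `‖D(F_ε∘φ)‖ ≤ ‖Dφ‖` and
  `‖D²(F_ε∘φ)‖ ≤ ‖D²φ‖ + ε⁻¹‖Dφ‖²`, also for the directional slices `D(F_ε∘φ)[n]`, `D(D(F_ε∘φ)[n])[n]`
  (`norm_fderiv_sqrtReg_le`, `norm_fderiv_fderiv_sqrtReg_le`, `abs_fderiv_fderiv_sqrtReg_apply_apply_le`);
* weights: `(1 + ‖x‖)³ a ≤ C ↔ a ≤ C (1 + ‖x‖)⁻³`, products of decaying bounds (`le_mul_rpow_neg_three`, …);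
* `f = ⟪curl v, n⟫ = (⟪n, ·⟫ ∘ curlCLM) ∘ Dv`, so `‖Dⁱf‖ ≤ ‖curlCLM‖ ‖Dⁱ⁺¹v‖` and likewise for `curl v`
  (`norm_iteratedFDeriv_inner_curl_le`, `norm_iteratedFDeriv_curl_le`; Mathlib
  `ContinuousLinearMap.iteratedFDeriv_comp_left`, `norm_iteratedFDeriv_fderiv`);
* the registered sub-goal `norm_fderiv_fderiv_sqrtReg_inner_curl_le`:
  `‖D²(F_ε∘f)(x)‖ ≤ ‖curlCLM‖‖D³v(x)‖ + ε⁻¹(‖curlCLM‖‖D²v(x)‖)²` for smooth `v` and a unit normal.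

Mathlib plus the tree's `curlCLM` dictionary (`VorticityCalculus`/`TaoEnstrophyLocalisation`). The decay
bounds along a field with cubic decay are in the sibling file `…FoldLawDecay`, the space–time part
(joint continuity, vorticity equation) in `…FoldLawSpaceTime`.
-/
noncomputable section

-- Problem = summit for this single-conjunct summit: the duplicate namespace component is deliberate.
set_option linter.dupNamespace false

namespace Summit.NavierStokesRegularity.NavierStokesRegularity.Theorems.SlicedKelvinPlanarFluxAPriori

open MeasureTheory Set Filter Topology
open scoped RealInnerProductSpace Laplacian ContDiff
open Literature.Analysis.FluidPDE

/-! ### The regularisation `F_ε(s) = √(s² + ε²)` -/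

/-- `0 < √(s² + ε²)` for `ε > 0`. -/
theorem sqrt_sq_add_sq_pos {ε : ℝ} (hε : 0 < ε) (s : ℝ) : 0 < Real.sqrt (s ^ 2 + ε ^ 2) :=
  Real.sqrt_pos.2 (by positivity)

/-- `ε ≤ √(s² + ε²)` for `ε ≥ 0`. -/
theorem le_sqrt_sq_add_sq {ε : ℝ} (hε : 0 ≤ ε) (s : ℝ) : ε ≤ Real.sqrt (s ^ 2 + ε ^ 2) := by
  calc ε = Real.sqrt (ε ^ 2) := (Real.sqrt_sq hε).symm
    _ ≤ Real.sqrt (s ^ 2 + ε ^ 2) := Real.sqrt_le_sqrt (by nlinarith)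

/-- `F_ε' = s / F_ε`: the derivative of `s ↦ √(s² + ε²)`. -/
theorem hasDerivAt_sqrt_sq_add_sq {ε : ℝ} (hε : 0 < ε) (s : ℝ) :
    HasDerivAt (fun s => Real.sqrt (s ^ 2 + ε ^ 2)) (s / Real.sqrt (s ^ 2 + ε ^ 2)) s := by
  have h1 : HasDerivAt (fun s => s ^ 2 + ε ^ 2) (2 * s) s := by
    simpa using (hasDerivAt_pow 2 s).add_const (ε ^ 2)
  have h2 := h1.sqrt (ne_of_gt (by positivity))
  refine h2.congr_deriv ?_
  have hF := sqrt_sq_add_sq_pos hε s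
  field_simp

/-- `F_ε'' = ε² / F_ε³`: the derivative of `s ↦ s / √(s² + ε²)`. -/
theorem hasDerivAt_div_sqrt_sq_add_sq {ε : ℝ} (hε : 0 < ε) (s : ℝ) :
    HasDerivAt (fun s => s / Real.sqrt (s ^ 2 + ε ^ 2))
      (ε ^ 2 / Real.sqrt (s ^ 2 + ε ^ 2) ^ 3) s := by
  have hF := sqrt_sq_add_sq_pos hε s
  have hF2 : Real.sqrt (s ^ 2 + ε ^ 2) ^ 2 = s ^ 2 + ε ^ 2 := Real.sq_sqrt (by positivity)
  have h := (hasDerivAt_id' s).fun_div (hasDerivAt_sqrt_sq_add_sq hε s) hF.ne'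
  refine h.congr_deriv ?_
  rw [div_eq_div_iff (by positivity) (by positivity)]
  have h3 : 1 * Real.sqrt (s ^ 2 + ε ^ 2) - s * (s / Real.sqrt (s ^ 2 + ε ^ 2)) =
      ε ^ 2 / Real.sqrt (s ^ 2 + ε ^ 2) := by
    field_simp
    nlinarith [hF2]
  rw [h3]
  field_simp

/-- `|F_ε'| ≤ 1`. -/
theorem abs_div_sqrt_sq_add_sq_le_one (s ε : ℝ) : |s / Real.sqrt (s ^ 2 + ε ^ 2)| ≤ 1 := by
  rw [abs_div, abs_of_nonneg (Real.sqrt_nonneg _)]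
  rcases eq_or_lt_of_le (Real.sqrt_nonneg (s ^ 2 + ε ^ 2)) with h | h
  · rw [← h, div_zero]; exact zero_le_one
  · rw [div_le_one h]; exact abs_le_sqrt_sq_add_sq s ε

/-- `0 ≤ F_ε'' = ε²/F_ε³`. -/
theorem sq_div_sqrt_cube_nonneg (s ε : ℝ) : 0 ≤ ε ^ 2 / Real.sqrt (s ^ 2 + ε ^ 2) ^ 3 := by
  positivity

/-- `F_ε'' = ε²/F_ε³ ≤ ε⁻¹` (since `F_ε ≥ ε`). -/
theorem sq_div_sqrt_cube_le {ε : ℝ} (hε : 0 < ε) (s : ℝ) :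
    ε ^ 2 / Real.sqrt (s ^ 2 + ε ^ 2) ^ 3 ≤ ε⁻¹ := by
  have hF := le_sqrt_sq_add_sq hε.le s
  have h3 : ε ^ 3 ≤ Real.sqrt (s ^ 2 + ε ^ 2) ^ 3 := by gcongr
  rw [div_le_iff₀ (by positivity)]
  calc ε ^ 2 = ε⁻¹ * ε ^ 3 := by field_simp
    _ ≤ ε⁻¹ * Real.sqrt (s ^ 2 + ε ^ 2) ^ 3 := by gcongr

/-- `ε²/F_ε ≤ ε`. -/
theorem sq_div_sqrt_le {ε : ℝ} (hε : 0 < ε) (s : ℝ) : ε ^ 2 / Real.sqrt (s ^ 2 + ε ^ 2) ≤ ε := by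
  rw [div_le_iff₀ (sqrt_sq_add_sq_pos hε s)]
  nlinarith [le_sqrt_sq_add_sq hε.le s, hε]

/-! ### Chain rules for `x ↦ F_ε(φ x)` -/

section Chain

variable {φ : EuclideanSpace ℝ (Fin 3) → ℝ} {ε : ℝ}

/-- `D(F_ε∘φ)(x) = F_ε'(φ x) • Dφ(x)`. -/
theorem hasFDerivAt_sqrtReg (hε : 0 < ε) {φ' : EuclideanSpace ℝ (Fin 3) →L[ℝ] ℝ}
    {x : EuclideanSpace ℝ (Fin 3)} (h : HasFDerivAt φ φ' x) :
    HasFDerivAt (fun x => Real.sqrt (φ x ^ 2 + ε ^ 2))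
      ((φ x / Real.sqrt (φ x ^ 2 + ε ^ 2)) • φ') x :=
  (hasDerivAt_sqrt_sq_add_sq hε (φ x)).comp_hasFDerivAt x h

/-- `D(F_ε∘φ) = (F_ε'∘φ) • Dφ` as functions, for differentiable `φ`. -/
theorem fderiv_sqrtReg (hε : 0 < ε) (hφ : Differentiable ℝ φ) :
    fderiv ℝ (fun x => Real.sqrt (φ x ^ 2 + ε ^ 2)) =
      fun x => (φ x / Real.sqrt (φ x ^ 2 + ε ^ 2)) • fderiv ℝ φ x :=
  funext fun x => (hasFDerivAt_sqrtReg hε (hφ x).hasFDerivAt).fderiv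

/-- `‖D(F_ε∘φ)(x)‖ ≤ ‖Dφ(x)‖`. -/
theorem norm_fderiv_sqrtReg_le (hε : 0 < ε) (hφ : Differentiable ℝ φ) (x : EuclideanSpace ℝ (Fin 3)) :
    ‖fderiv ℝ (fun x => Real.sqrt (φ x ^ 2 + ε ^ 2)) x‖ ≤ ‖fderiv ℝ φ x‖ := by
  rw [fderiv_sqrtReg hε hφ]
  dsimp only
  rw [norm_smul, Real.norm_eq_abs]
  calc _ ≤ 1 * ‖fderiv ℝ φ x‖ := by gcongr; exact abs_div_sqrt_sq_add_sq_le_one _ _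
    _ = _ := one_mul _

/-- The second derivative of `F_ε∘φ` for `φ ∈ C²`:
`D²(F_ε∘φ)(x) = F_ε'(φ x) • D²φ(x) + (F_ε''(φ x) • Dφ(x)) ⊗ Dφ(x)`. -/
theorem hasFDerivAt_fderiv_sqrtReg (hε : 0 < ε) (hφ : ContDiff ℝ 2 φ) (x : EuclideanSpace ℝ (Fin 3)) :
    HasFDerivAt (fderiv ℝ (fun x => Real.sqrt (φ x ^ 2 + ε ^ 2)))
      ((φ x / Real.sqrt (φ x ^ 2 + ε ^ 2)) • fderiv ℝ (fderiv ℝ φ) x +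
        ((ε ^ 2 / Real.sqrt (φ x ^ 2 + ε ^ 2) ^ 3) • fderiv ℝ φ x).smulRight (fderiv ℝ φ x)) x := by
  have hd : Differentiable ℝ φ := hφ.differentiable two_ne_zero
  rw [fderiv_sqrtReg hε hd]
  have h1 : HasFDerivAt (fun x => φ x / Real.sqrt (φ x ^ 2 + ε ^ 2))
      ((ε ^ 2 / Real.sqrt (φ x ^ 2 + ε ^ 2) ^ 3) • fderiv ℝ φ x) x :=
    (hasDerivAt_div_sqrt_sq_add_sq hε (φ x)).comp_hasFDerivAt x (hd x).hasFDerivAt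
  have h2 : HasFDerivAt (fderiv ℝ φ) (fderiv ℝ (fderiv ℝ φ) x) x :=
    ((hφ.fderiv_right (m := 1) (by norm_num)).differentiable one_ne_zero x).hasFDerivAt
  exact h1.smul h2

/-- `‖D²(F_ε∘φ)(x)‖ ≤ ‖D²φ(x)‖ + ε⁻¹ ‖Dφ(x)‖²` for `φ ∈ C²`. -/
theorem norm_fderiv_fderiv_sqrtReg_le (hε : 0 < ε) (hφ : ContDiff ℝ 2 φ) (x : EuclideanSpace ℝ (Fin 3)) :
    ‖fderiv ℝ (fderiv ℝ (fun x => Real.sqrt (φ x ^ 2 + ε ^ 2))) x‖ ≤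
      ‖fderiv ℝ (fderiv ℝ φ) x‖ + ε⁻¹ * ‖fderiv ℝ φ x‖ ^ 2 := by
  rw [(hasFDerivAt_fderiv_sqrtReg hε hφ x).fderiv]
  refine (ContinuousLinearMap.opNorm_add_le _ _).trans (add_le_add ?_ ?_)
  · refine (ContinuousLinearMap.opNorm_smul_le _ _).trans ?_
    rw [Real.norm_eq_abs]
    calc _ ≤ 1 * ‖fderiv ℝ (fderiv ℝ φ) x‖ := by gcongr; exact abs_div_sqrt_sq_add_sq_le_one _ _
      _ = _ := one_mul _
  · calc ‖((ε ^ 2 / Real.sqrt (φ x ^ 2 + ε ^ 2) ^ 3) • fderiv ℝ φ x).smulRight (fderiv ℝ φ x)‖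
          = ‖(ε ^ 2 / Real.sqrt (φ x ^ 2 + ε ^ 2) ^ 3) • fderiv ℝ φ x‖ * ‖fderiv ℝ φ x‖ :=
            ContinuousLinearMap.norm_smulRight_apply _ _
        _ = (ε ^ 2 / Real.sqrt (φ x ^ 2 + ε ^ 2) ^ 3) * ‖fderiv ℝ φ x‖ * ‖fderiv ℝ φ x‖ := by
            rw [norm_smul, Real.norm_eq_abs, abs_of_nonneg (sq_div_sqrt_cube_nonneg _ _)]
        _ ≤ ε⁻¹ * ‖fderiv ℝ φ x‖ * ‖fderiv ℝ φ x‖ := by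
            gcongr
            exact sq_div_sqrt_cube_le hε _
        _ = ε⁻¹ * ‖fderiv ℝ φ x‖ ^ 2 := by ring

/-- The directional slice `x ↦ D(F_ε∘φ)(x)[n]` is `C¹` with derivative `v ↦ D²(F_ε∘φ)(x)[v][n]`, and
`|D(D(F_ε∘φ)[n])(x)[n]|`, `‖D(D(F_ε∘φ)[n])(x)‖ ≤ (‖D²φ(x)‖ + ε⁻¹‖Dφ(x)‖²)` for a unit vector `n`. -/
theorem hasFDerivAt_fderiv_sqrtReg_apply (hε : 0 < ε) (hφ : ContDiff ℝ 2 φ)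
    (x n : EuclideanSpace ℝ (Fin 3)) :
    HasFDerivAt (fun x => fderiv ℝ (fun x => Real.sqrt (φ x ^ 2 + ε ^ 2)) x n)
      ((fderiv ℝ (fderiv ℝ (fun x => Real.sqrt (φ x ^ 2 + ε ^ 2))) x).flip n) x := by
  have h : HasFDerivAt (fderiv ℝ (fun x => Real.sqrt (φ x ^ 2 + ε ^ 2)))
      (fderiv ℝ (fderiv ℝ (fun x => Real.sqrt (φ x ^ 2 + ε ^ 2))) x) x :=
    (hasFDerivAt_fderiv_sqrtReg hε hφ x).differentiableAt.hasFDerivAt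
  have := h.clm_apply (hasFDerivAt_const n x)
  simpa using this

/-- Norm of the derivative of the directional slice: `‖D(D(F_ε∘φ)[n])(x)‖ ≤ ‖D²φ(x)‖ + ε⁻¹‖Dφ(x)‖²`
for `‖n‖ = 1`. -/
theorem norm_fderiv_fderiv_sqrtReg_apply_le (hε : 0 < ε) (hφ : ContDiff ℝ 2 φ)
    (x : EuclideanSpace ℝ (Fin 3)) {n : EuclideanSpace ℝ (Fin 3)} (hn : ‖n‖ = 1) :
    ‖fderiv ℝ (fun x => fderiv ℝ (fun x => Real.sqrt (φ x ^ 2 + ε ^ 2)) x n) x‖ ≤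
      ‖fderiv ℝ (fderiv ℝ φ) x‖ + ε⁻¹ * ‖fderiv ℝ φ x‖ ^ 2 := by
  rw [(hasFDerivAt_fderiv_sqrtReg_apply hε hφ x n).fderiv]
  calc _ ≤ ‖(fderiv ℝ (fderiv ℝ (fun x => Real.sqrt (φ x ^ 2 + ε ^ 2))) x).flip‖ * ‖n‖ :=
        ContinuousLinearMap.le_opNorm _ _
    _ = ‖fderiv ℝ (fderiv ℝ (fun x => Real.sqrt (φ x ^ 2 + ε ^ 2))) x‖ := by
        rw [ContinuousLinearMap.opNorm_flip, hn, mul_one]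
    _ ≤ _ := norm_fderiv_fderiv_sqrtReg_le hε hφ x

/-- The second directional derivative: `|D(D(F_ε∘φ)[n])(x)[n]| ≤ ‖D²φ(x)‖ + ε⁻¹‖Dφ(x)‖²` for
`‖n‖ = 1`. -/
theorem abs_fderiv_fderiv_sqrtReg_apply_apply_le (hε : 0 < ε) (hφ : ContDiff ℝ 2 φ)
    (x : EuclideanSpace ℝ (Fin 3)) {n : EuclideanSpace ℝ (Fin 3)} (hn : ‖n‖ = 1) :
    |fderiv ℝ (fun x => fderiv ℝ (fun x => Real.sqrt (φ x ^ 2 + ε ^ 2)) x n) x n| ≤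
      ‖fderiv ℝ (fderiv ℝ φ) x‖ + ε⁻¹ * ‖fderiv ℝ φ x‖ ^ 2 := by
  rw [← Real.norm_eq_abs]
  calc _ ≤ ‖fderiv ℝ (fun x => fderiv ℝ (fun x => Real.sqrt (φ x ^ 2 + ε ^ 2)) x n) x‖ * ‖n‖ :=
        ContinuousLinearMap.le_opNorm _ _
    _ ≤ _ := by rw [hn, mul_one]; exact norm_fderiv_fderiv_sqrtReg_apply_le hε hφ x hn

/-- The first directional derivative: `|D(F_ε∘φ)(x)[n]| ≤ ‖Dφ(x)‖` for `‖n‖ = 1`. -/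
theorem abs_fderiv_sqrtReg_apply_le (hε : 0 < ε) (hφ : Differentiable ℝ φ)
    (x : EuclideanSpace ℝ (Fin 3)) {n : EuclideanSpace ℝ (Fin 3)} (hn : ‖n‖ = 1) :
    |fderiv ℝ (fun x => Real.sqrt (φ x ^ 2 + ε ^ 2)) x n| ≤ ‖fderiv ℝ φ x‖ := by
  rw [← Real.norm_eq_abs]
  calc _ ≤ ‖fderiv ℝ (fun x => Real.sqrt (φ x ^ 2 + ε ^ 2)) x‖ * ‖n‖ :=
        ContinuousLinearMap.le_opNorm _ _
    _ ≤ _ := by rw [hn, mul_one]; exact norm_fderiv_sqrtReg_le hε hφ x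

end Chain

/-! ### Weights -/

/-- Conversion of the decay hypothesis: `(1 + ‖x‖)³ a ≤ C` gives `a ≤ C (1 + ‖x‖)⁻³`. -/
theorem le_mul_rpow_neg_three {X : Type*} [NormedAddCommGroup X] {x : X} {a C : ℝ}
    (h : (1 + ‖x‖) ^ 3 * a ≤ C) : a ≤ C * (1 + ‖x‖) ^ (-(3 : ℝ)) := by
  have hpos : 0 < (1 + ‖x‖) ^ 3 := by positivity
  rw [Real.rpow_neg (by positivity), Real.rpow_ofNat, ← div_eq_mul_inv, le_div_iff₀ hpos]
  linarith [mul_comm ((1 + ‖x‖) ^ 3) a]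

/-- The weight is at most one. -/
theorem rpow_neg_three_le_one {X : Type*} [NormedAddCommGroup X] (x : X) :
    (1 + ‖x‖) ^ (-(3 : ℝ)) ≤ 1 :=
  Real.rpow_le_one_of_one_le_of_nonpos (by simp) (by norm_num)

/-- Products of two decaying bounds decay: `(C₁ w)(C₂ w) ≤ C₁ C₂ w` for `C₁, C₂ ≥ 0`. -/
theorem mul_weight_mul_weight_le {X : Type*} [NormedAddCommGroup X] (x : X) {C₁ C₂ : ℝ}
    (h₁ : 0 ≤ C₁) (h₂ : 0 ≤ C₂) :
    C₁ * (1 + ‖x‖) ^ (-(3 : ℝ)) * (C₂ * (1 + ‖x‖) ^ (-(3 : ℝ))) ≤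
      C₁ * C₂ * (1 + ‖x‖) ^ (-(3 : ℝ)) := by
  have hw : 0 ≤ (1 + ‖x‖) ^ (-(3 : ℝ)) := by positivity
  have hw1 := rpow_neg_three_le_one x
  calc C₁ * (1 + ‖x‖) ^ (-(3 : ℝ)) * (C₂ * (1 + ‖x‖) ^ (-(3 : ℝ)))
      = C₁ * C₂ * (1 + ‖x‖) ^ (-(3 : ℝ)) * (1 + ‖x‖) ^ (-(3 : ℝ)) := by ring
    _ ≤ C₁ * C₂ * (1 + ‖x‖) ^ (-(3 : ℝ)) * 1 := by gcongr
    _ = _ := mul_one _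

/-- The decay hypothesis of the stub in `rpow` form: `‖Dᵏv(x)‖ ≤ C (1 + ‖x‖)⁻³`, `k ≤ 3`. -/
theorem norm_iteratedFDeriv_le_of_decay {v : EuclideanSpace ℝ (Fin 3) → EuclideanSpace ℝ (Fin 3)}
    {C : ℝ} (hC : ∀ (x : EuclideanSpace ℝ (Fin 3)) (k : ℕ), k ≤ 3 →
      (1 + ‖x‖) ^ 3 * ‖iteratedFDeriv ℝ k v x‖ ≤ C) {k : ℕ} (hk : k ≤ 3)
    (x : EuclideanSpace ℝ (Fin 3)) : ‖iteratedFDeriv ℝ k v x‖ ≤ C * (1 + ‖x‖) ^ (-(3 : ℝ)) :=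
  le_mul_rpow_neg_three (hC x k hk)

/-- The decay constant is nonnegative. -/
theorem decay_const_nonneg {v : EuclideanSpace ℝ (Fin 3) → EuclideanSpace ℝ (Fin 3)}
    {C : ℝ} (hC : ∀ (x : EuclideanSpace ℝ (Fin 3)) (k : ℕ), k ≤ 3 →
      (1 + ‖x‖) ^ 3 * ‖iteratedFDeriv ℝ k v x‖ ≤ C) : 0 ≤ C :=
  le_trans (by positivity) (hC 0 0 (by norm_num))

/-! ### `f = ⟪curl v, n⟫` as a linear image of the velocity gradient -/

section Field

variable {v : EuclideanSpace ℝ (Fin 3) → EuclideanSpace ℝ (Fin 3)}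

/-- The frame vectors `R eᵢ` are unit vectors. -/
theorem norm_frame (R : EuclideanSpace ℝ (Fin 3) ≃ₗᵢ[ℝ] EuclideanSpace ℝ (Fin 3)) (i : Fin 3) :
    ‖R (EuclideanSpace.single i (1 : ℝ))‖ = 1 := by
  rw [LinearIsometryEquiv.norm_map, PiLp.norm_single, norm_one]

/-- `|⟪a, n⟫| ≤ ‖a‖` for a unit vector `n`. -/
theorem abs_inner_unit_le (a : EuclideanSpace ℝ (Fin 3)) {n : EuclideanSpace ℝ (Fin 3)} (hn : ‖n‖ = 1) :
    |⟪a, n⟫| ≤ ‖a‖ := by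
  calc |⟪a, n⟫| ≤ ‖a‖ * ‖n‖ := abs_real_inner_le_norm a n
    _ = ‖a‖ := by rw [hn, mul_one]

/-- `‖⟪n, ·⟫‖ = 1` as a continuous linear form, for a unit vector `n`. -/
theorem norm_innerSL_unit {n : EuclideanSpace ℝ (Fin 3)} (hn : ‖n‖ = 1) :
    ‖innerSL ℝ n‖ = 1 := by
  rw [innerSL_apply_norm, hn]

/-- `‖fderiv ℝ g x‖ = ‖iteratedFDeriv ℝ 1 g x‖`. -/
theorem norm_fderiv_eq_norm_iteratedFDeriv_one {F' : Type*} [NormedAddCommGroup F'] [NormedSpace ℝ F']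
    (g : EuclideanSpace ℝ (Fin 3) → F') (x : EuclideanSpace ℝ (Fin 3)) :
    ‖fderiv ℝ g x‖ = ‖iteratedFDeriv ℝ 1 g x‖ := by
  rw [← norm_iteratedFDeriv_fderiv, norm_iteratedFDeriv_zero]

/-- `‖fderiv ℝ (fderiv ℝ g) x‖ = ‖iteratedFDeriv ℝ 2 g x‖`. -/
theorem norm_fderiv_fderiv_eq_norm_iteratedFDeriv_two {F' : Type*} [NormedAddCommGroup F']
    [NormedSpace ℝ F'] (g : EuclideanSpace ℝ (Fin 3) → F') (x : EuclideanSpace ℝ (Fin 3)) :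
    ‖fderiv ℝ (fderiv ℝ g) x‖ = ‖iteratedFDeriv ℝ 2 g x‖ := by
  rw [← norm_iteratedFDeriv_fderiv, ← norm_iteratedFDeriv_fderiv, norm_iteratedFDeriv_zero]

/-- `⟪curl v x, n⟫ = (⟪n, ·⟫ ∘ curlCLM) (Dv(x))`: the normal vorticity is a fixed linear image of the
velocity gradient. -/
theorem inner_curl_eq_comp_fderiv (v : EuclideanSpace ℝ (Fin 3) → EuclideanSpace ℝ (Fin 3))
    (n : EuclideanSpace ℝ (Fin 3)) :
    (fun x => ⟪curl v x, n⟫) = ⇑((innerSL ℝ n).comp curlCLM) ∘ fderiv ℝ v := by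
  funext x
  simp only [Function.comp_apply, ContinuousLinearMap.coe_comp, coe_innerSL_apply, curl_eq_curlCLM]
  exact real_inner_comm _ _

/-- `‖Dⁱ(curl v)(x)‖ ≤ ‖curlCLM‖ ‖Dⁱ⁺¹v(x)‖` for smooth `v`. -/
theorem norm_iteratedFDeriv_curl_le (hv : ContDiff ℝ ∞ v) (i : ℕ) (x : EuclideanSpace ℝ (Fin 3)) :
    ‖iteratedFDeriv ℝ i (curl v) x‖ ≤ ‖curlCLM‖ * ‖iteratedFDeriv ℝ (i + 1) v x‖ := by
  have hDv : ContDiff ℝ ∞ (fderiv ℝ v) := hv.fderiv_right (m := ∞) (by simp)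
  rw [curl_eq_curlCLM_comp, ContinuousLinearMap.iteratedFDeriv_comp_left _ hDv.contDiffAt
    (i := i) (by exact_mod_cast le_top), ← norm_iteratedFDeriv_fderiv]
  exact ContinuousLinearMap.norm_compContinuousMultilinearMap_le _ _

/-- `‖Dⁱ f(x)‖ ≤ ‖curlCLM‖ ‖Dⁱ⁺¹ v(x)‖` for `f = ⟪curl v, n⟫`, `‖n‖ = 1`, `v` smooth. -/
theorem norm_iteratedFDeriv_inner_curl_le (hv : ContDiff ℝ ∞ v) {n : EuclideanSpace ℝ (Fin 3)}
    (hn : ‖n‖ = 1) (i : ℕ) (x : EuclideanSpace ℝ (Fin 3)) :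
    ‖iteratedFDeriv ℝ i (fun x => ⟪curl v x, n⟫) x‖ ≤ ‖curlCLM‖ * ‖iteratedFDeriv ℝ (i + 1) v x‖ := by
  have hDv : ContDiff ℝ ∞ (fderiv ℝ v) := hv.fderiv_right (m := ∞) (by simp)
  rw [inner_curl_eq_comp_fderiv v n, ContinuousLinearMap.iteratedFDeriv_comp_left _ hDv.contDiffAt
    (i := i) (by exact_mod_cast le_top), ← norm_iteratedFDeriv_fderiv]
  refine (ContinuousLinearMap.norm_compContinuousMultilinearMap_le _ _).trans
    (mul_le_mul_of_nonneg_right ?_ (norm_nonneg _))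
  refine (ContinuousLinearMap.opNorm_comp_le _ _).trans ?_
  rw [norm_innerSL_unit hn, one_mul]

/-- The normal vorticity `f = ⟪curl v, n⟫` of a smooth field is smooth. -/
theorem contDiff_inner_curl (hv : ContDiff ℝ ∞ v) (n : EuclideanSpace ℝ (Fin 3)) :
    ContDiff ℝ ∞ (fun x => ⟪curl v x, n⟫) := by
  rw [inner_curl_eq_comp_fderiv v n]
  exact (ContinuousLinearMap.contDiff _).comp (hv.fderiv_right (m := ∞) (by simp))

/-- The curl of a smooth field is smooth. -/
theorem contDiff_curl (hv : ContDiff ℝ ∞ v) : ContDiff ℝ ∞ (curl v) := by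
  rw [curl_eq_curlCLM_comp]
  exact curlCLM.contDiff.comp (hv.fderiv_right (m := ∞) (by simp))

/-- The regularised normal vorticity `F_ε(f) = √(f² + ε²)` of a smooth field is smooth (`ε > 0`). -/
theorem contDiff_sqrtReg_inner_curl (hv : ContDiff ℝ ∞ v) {ε : ℝ} (hε : 0 < ε)
    (n : EuclideanSpace ℝ (Fin 3)) :
    ContDiff ℝ ∞ (fun x => Real.sqrt (⟪curl v x, n⟫ ^ 2 + ε ^ 2)) :=
  (((contDiff_inner_curl hv n).pow 2).add contDiff_const).sqrt fun x => ne_of_gt (by positivity)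

/-- `‖D⟪g, n⟫(x)‖ ≤ ‖Dg(x)‖` for a unit vector `n`. -/
theorem norm_fderiv_inner_const_le {g : EuclideanSpace ℝ (Fin 3) → EuclideanSpace ℝ (Fin 3)}
    {x : EuclideanSpace ℝ (Fin 3)} (hg : DifferentiableAt ℝ g x) {n : EuclideanSpace ℝ (Fin 3)}
    (hn : ‖n‖ = 1) : ‖fderiv ℝ (fun z => ⟪g z, n⟫) x‖ ≤ ‖fderiv ℝ g x‖ := by
  have hfun : (fun z => ⟪g z, n⟫) = ⇑(innerSL ℝ n) ∘ g := by
    funext z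
    simp only [Function.comp_apply, coe_innerSL_apply]
    exact real_inner_comm _ _
  have h : HasFDerivAt (fun z => ⟪g z, n⟫) ((innerSL ℝ n).comp (fderiv ℝ g x)) x := by
    rw [hfun]
    exact (innerSL ℝ n).hasFDerivAt.comp x hg.hasFDerivAt
  rw [h.fderiv]
  refine (ContinuousLinearMap.opNorm_comp_le _ _).trans ?_
  rw [norm_innerSL_unit hn, one_mul]

/-- **Second derivative of the regularised normal vorticity** (registered sub-goal of
`stub_foldLawPackage`): for a smooth field `v`, `ε > 0` and a unit vector `n`, with `f = ⟪curl v, n⟫`,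
`‖D²(√(f² + ε²))(x)‖ ≤ ‖curlCLM‖ ‖D³v(x)‖ + ε⁻¹ (‖curlCLM‖ ‖D²v(x)‖)²` — the second normal derivative of the
regularised flux density is controlled by the second and third velocity derivatives. -/
theorem norm_fderiv_fderiv_sqrtReg_inner_curl_le : ∀ (v : EuclideanSpace ℝ (Fin 3) → EuclideanSpace ℝ (Fin 3)) (ε : ℝ) (n : EuclideanSpace ℝ (Fin 3)), ContDiff ℝ (⊤ : ℕ∞) v → 0 < ε → ‖n‖ = 1 → ∀ (x : EuclideanSpace ℝ (Fin 3)), ‖fderiv ℝ (fderiv ℝ (fun x => Real.sqrt (inner ℝ (Literature.Analysis.FluidPDE.curl v x) n ^ 2 + ε ^ 2))) x‖ ≤ ‖Literature.Analysis.FluidPDE.curlCLM‖ * ‖iteratedFDeriv ℝ 3 v x‖ + ε⁻¹ * (‖Literature.Analysis.FluidPDE.curlCLM‖ * ‖iteratedFDeriv ℝ 2 v x‖) ^ 2 := by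
  intro v ε n hv hε hn x
  have h2 : ContDiff ℝ 2 (fun x => ⟪curl v x, n⟫) := (contDiff_inner_curl hv n).of_le (by norm_cast)
  refine (norm_fderiv_fderiv_sqrtReg_le hε h2 x).trans (add_le_add ?_ ?_)
  · rw [norm_fderiv_fderiv_eq_norm_iteratedFDeriv_two]
    exact norm_iteratedFDeriv_inner_curl_le hv hn 2 x
  · refine mul_le_mul_of_nonneg_left ?_ (inv_nonneg.2 hε.le)
    have h1 : ‖fderiv ℝ (fun x => ⟪curl v x, n⟫) x‖ ≤ ‖curlCLM‖ * ‖iteratedFDeriv ℝ 2 v x‖ := by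
      rw [norm_fderiv_eq_norm_iteratedFDeriv_one]
      exact norm_iteratedFDeriv_inner_curl_le hv hn 1 x
    exact pow_le_pow_left₀ (norm_nonneg _) h1 2

end Field

end Summit.NavierStokesRegularity.NavierStokesRegularity.Theorems.SlicedKelvinPlanarFluxAPriori

end
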